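/-
Copyright (c) 2026 the pub-hodgecm-mathlib formalisation cell (harness21).  Prover seat hodgecm-mathlib-K2Liu-p03 (g9), Track B «K2-LIT» ∕ hLiu418 #184♮ =
`stmt-HodgeConjecture-24832`, socket #41 KIND 1, block K1-b♮ (dec-2-pay) F3 (translate-size letters, LEAD F0P6-plan (g16) BATCH #304's `hFx′` road): «THE VALUE OF A
LOCAL SIEGEL SECTION AT THE TRANSLATED CORNER ARGUMENT `B_v(u)·g_v` IS BOUNDED BY A POWER OF `max(1, |u|)·∏_{w∣v} H_w(g)`; FOR THE UNRAMIFIED SECTION `Λ_{s,v}` THE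
CONSTANT IS `1` AT EVERY PLACE».  THEOREMS ONLY (no `def`, no `instance`, no notation, no named-fact hypothesis, no `sorry`); lane `--supports stmt-HodgeConjecture-24832 --as helper`.
-/
import Summits.HodgeConjecture.HodgeConjecture.Theorems.K2LiuLocalSiegelSectionEntrySize     -- ★ p865375: the ENGINE `norm_section_le_of_decomp`, `norm_coe_mul_apply_le`
import Summits.HodgeConjecture.HodgeConjecture.Theorems.K2LiuKindOneLineLocalPullback         -- ★ (e3-loc): the local corner chart `B_v`, ★ (e2) `coe_evalPlace_finPart_blkD_apply`
import Summits.HodgeConjecture.HodgeConjecture.Theorems.K2LiuKindWFiniteSectionSupBound       -- ★ `norm_apply_le_one_of_mem_localInt`, `norm_apply_evalPlace_le_localHeight`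
import Literature.NumberTheory.K2Lit.LocalDoublingSiegel                                     -- ★ `LambdaLoc`, `lambdaLoc_mem_localDegPS`, `lambdaLoc_of_mem_localInt`, `lambdaLoc_eq_zero`
import Literature.NumberTheory.Automorphic.AdelicHeightGLProofs                              -- ★ `GLn.one_le_localHeight`
import HarnessLib

/-!
# Crux `HLiu418`, socket #41, KIND 1 b♮ (dec-2-pay) F3 — `K2LiuKindOneLineLocalTranslateSize`: ENTRY-SIZE LETTERS OF THE TRANSLATED CORNER ARGUMENT

Cell `hodgecm-mathlib`, crux item hLiu418 = `stmt-HodgeConjecture-24832` (helper lane, count-neutral).  Namespace `…Cruxes.HLiu418.K2LiuKindOneLineLocalTranslateSize`.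
WHY.  The residual letter `hFx′` of ★ p865287 `hFfin_of_translateHeightBound` (typ2 v44 :375) asks for `‖Ffin i σf g s‖ ≤ Cf · H(g)^{af}` locally uniformly in `s`;
by F2γ's `Ffin_def` the `g`-dependence of `Ffin` is through the local integrals `∫_{N_v} conj ψ(y) Φ_{i,v}(B_v((w_δ)_v y)·g_v) dν_v` over the places `v ∈ T′(σf, g)`,
whose absolute majorant (★ F3-loc `K2LiuKindOneLineLocalAbsoluteMajorant` §2) needs exactly two VALUE LETTERS `hnear ∕ hfar`: a bound for `‖Φ_{i,v}(B_v(u)·g_v)‖` at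
the coset representatives `u`.  THIS FILE pays them in the currency of ★ F3-asm `hFfin_of_placeBounds` (`∏_{w∣v} H_w(g)`), for every section with an ENTRY-SIZE LETTER:
* §1 **entries of the translated corner argument** — `B_v(u)_w = σ⁻¹[diag(1, u_w)]` (★ (e2) `coe_evalPlace_finPart_blkD_apply`), so the entries of `(B_v(u)·x)_w` have norm
  `≤ max(1, R_u) · R_x` (ultrametric, ★ `norm_coe_mul_apply_le`), and `≤ max(1, R_u) · H_w(g)` at `x = g_v` (★ `norm_apply_evalPlace_le_localHeight`);
* §2 **the unramified section has entry-size constant `1` at EVERY place** — `‖Λ_{s,v}(g)‖ ≤ (∏_{w∣v} R_w^n)^{re s + n∕2}` whenever the entries of `g_w` have norm `≤ R_w`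
  (`R_w ≥ 1`, `χ` unitary and unramified above `v`, `0 ≤ re s + n∕2`): either `g ∉ P_Δ·K_{H,v}` (`Λ = 0`, ★ `lambdaLoc_eq_zero`) or `g = p·κ`, and then the ENGINE
  ★ `norm_section_le_of_decomp` (Siegel law ★ `lambdaLoc_mem_localDegPS`, `Λ(κ) = 1` ★ `lambdaLoc_of_mem_localInt`, `|κ⁻¹| ≤ 1` ★ `norm_apply_le_one_of_mem_localInt`) —
  no Iwasawa-compactness input and no `‖2‖_w⁻¹` loss;
* §3 **the value letters** — for any `Φ` with an entry-size letter `‖Φ g′‖ ≤ B_Φ (∏_w R_w^n)^{e_Φ}`: `‖Φ(B_v(u)·x)‖ ≤ B_Φ (∏_w (max(1,R_u) R_{x,w})^n)^{e_Φ}`, and at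
  `x = g_v`: `≤ B_Φ (∏_w (max(1,R_u) H_w(g))^n)^{e_Φ}`; for `Λ_{s,v}`: `‖Λ_{s,v}(B_v(u)·g_v)‖ ≤ (∏_w (max(1,R_u) H_w(g))^n)^{re s + n∕2}`.
References: [BorelJacquet1979, §1.2, §4.1]; [Kudla1994, §2–§3]; [KudlaRallis1994, §2]; [Li1992, §3]; [HarrisKudlaSweet1996, §1 (1.15)]; [Casselman1980, §3];
[Shimura1997, §18.4 Prop. 18.14].
HONEST LABEL: HC_CM is proved only modulo the 7 printed citations (2 remaining named inputs: hLiu418 = stmt-HodgeConjecture-24832, h413 = stmt-HodgeConjecture-24833) until rung 0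
closes; count-neutral helper (`--supports stmt-HodgeConjecture-24832 --as helper`).
-/

set_option autoImplicit false
set_option linter.dupNamespace false -- the mandated namespace repeats `HodgeConjecture.HodgeConjecture`

noncomputable section

open scoped Matrix
open NumberField IsDedekindDomain
open Literature.NumberTheory.Automorphic Literature.NumberTheory.GaloisRepresentations
open Literature.NumberTheory.GelbartRogawski1991 Literature.NumberTheory.GelbartRogawski1991.GRConstruction
open Literature.NumberTheory.GelbartRogawski1991.UnitaryDualPair
open Literature.NumberTheory.K2Lit Literature.NumberTheory.K2Lit.SiegelDoubled
open Summit.HodgeConjecture.HodgeConjecture.Cruxes.HLiu418.K2LiuBlockDiagPlaces (coe_evalPlace_finPart_blkD_apply)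
open Summit.HodgeConjecture.HodgeConjecture.Cruxes.HLiu418.K2LiuLocalSiegelSectionEntrySize (norm_coe_mul_apply_le norm_section_le_of_decomp)
open Summit.HodgeConjecture.HodgeConjecture.Cruxes.HLiu418.K2LiuKindWFiniteSectionSupBound (norm_apply_le_one_of_mem_localInt norm_apply_evalPlace_le_localHeight)

namespace Summit.HodgeConjecture.HodgeConjecture.Cruxes.HLiu418.K2LiuKindOneLineLocalTranslateSize

variable (L : Type) [Field L] [NumberField L] [IsCMField L]

/-! ## §1 Entries of the translated corner argument `B_v(u)·x` -/

section Corner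

variable {N₁ N₂ M n n₁ n₂ : ℕ} (eV : Fin (N₁ + N₂) × Fin M ≃ Fin n) (eA : Fin N₁ × Fin M ≃ Fin n₁) (eB : Fin N₂ × Fin M ≃ Fin n₂)
  (dA : Fin N₁ → L) (hdA : ∀ i, IsCMField.complexConj L (dA i) = dA i)
  (dB : Fin N₂ → L) (hdB : ∀ i, IsCMField.complexConj L (dB i) = dB i)
  (dV : Fin (N₁ + N₂) → L) (hdV : ∀ i, IsCMField.complexConj L (dV i) = dV i)
  (hVA : ∀ i, dV (Fin.castAdd N₂ i) = dA i) (hVB : ∀ j, dV (Fin.natAdd N₁ j) = dB j)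
  (dW : Fin M → L) (hdW : ∀ i, IsCMField.complexConj L (dW i) = dW i)
  (v : HeightOneSpectrum (𝓞 (Fp L)))

/-- **entries of the local corner chart**: if the `w`-component of `u ∈ H^{(B)}(L⁺_v)` has entries of norm `≤ R_u`, the `w`-component of `B_v(u) = (blkD(1, ι_v u))_v` has
entries of norm `≤ max(1, R_u)` — it is the see-saw permutation of `diag(1, u_w)` (★ (e2) `coe_evalPlace_finPart_blkD_apply`, `(ι_v u)_v = u`). [cite: Kudla1994, §2] [cite: BorelJacquet1979, §4.1] -/
theorem norm_cornerLoc_apply_le (u : UnitaryGroup.localPi L (IsCMField.complexConj L) (n₂ + n₂) (hermD L eB dB hdB dW hdW) v) (w : UnitaryGroup.PlacesOver L v) {Ru : ℝ}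
    (hu : ∀ a b, ‖(((u : UnitaryGroup.LocalGLPi L (n₂ + n₂) v) w : GL (Fin (n₂ + n₂)) (w.1.adicCompletion L)) : Matrix (Fin (n₂ + n₂)) (Fin (n₂ + n₂)) (w.1.adicCompletion L)) a b‖ ≤ Ru)
    (a b : Fin (n + n)) :
    ‖((((UnitaryGroup.evalPlace (Fp L) L (IsCMField.complexConj L) (n + n) (hermD L eV dV hdV dW hdW) v (UnitaryGroup.finPart (Fp L) L (IsCMField.complexConj L) (n + n) (hermD L eV dV hdV dW hdW)
        (blkD L eV eA eB dA hdA dB hdB dV hdV hVA hVB dW hdW (1, locToAdelic L eB dB hdB dW hdW v u))) : UnitaryGroup.localPi L (IsCMField.complexConj L) (n + n) (hermD L eV dV hdV dW hdW) v) :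
        UnitaryGroup.LocalGLPi L (n + n) v) w : GL (Fin (n + n)) (w.1.adicCompletion L)) : Matrix (Fin (n + n)) (Fin (n + n)) (w.1.adicCompletion L)) a b‖ ≤ max 1 Ru := by
  have h1 : UnitaryGroup.finPart (Fp L) L (IsCMField.complexConj L) (n₁ + n₁) (hermD L eA dA hdA dW hdW) (1 : HA L eA dA hdA dW hdW) = 1 := map_one _
  have hself : UnitaryGroup.evalPlace (Fp L) L (IsCMField.complexConj L) (n₂ + n₂) (hermD L eB dB hdB dW hdW) v
      (UnitaryGroup.finPart (Fp L) L (IsCMField.complexConj L) (n₂ + n₂) (hermD L eB dB hdB dW hdW) (locToAdelic L eB dB hdB dW hdW v u)) = u :=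
    UnitaryGroup.evalPlace_finPart_inclPlaceAdelic (Fp L) L (IsCMField.complexConj L) (n₂ + n₂) (hermD L eB dB hdB dW hdW) v u
  rw [coe_evalPlace_finPart_blkD_apply]
  dsimp only
  rw [h1, map_one, hself]
  generalize idxSplitD eV eA eB a = z
  generalize idxSplitD eV eA eB b = z'
  rcases z with i | i <;> rcases z' with j | j
  · rw [Matrix.fromBlocks_apply₁₁, OneMemClass.coe_one, Pi.one_apply, Units.val_one, Matrix.one_apply]
    split_ifs
    · rw [norm_one]; exact le_max_left _ _
    · rw [norm_zero]; exact zero_le_one.trans (le_max_left _ _)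
  · rw [Matrix.fromBlocks_apply₁₂, Matrix.zero_apply, norm_zero]; exact zero_le_one.trans (le_max_left _ _)
  · rw [Matrix.fromBlocks_apply₂₁, Matrix.zero_apply, norm_zero]; exact zero_le_one.trans (le_max_left _ _)
  · rw [Matrix.fromBlocks_apply₂₂]; exact (hu i j).trans (le_max_right _ _)

/-- **entries of the translated corner argument `B_v(u)·x`**: `≤ max(1, R_u)·R_x` (§1 and the ultrametric product bound ★ `norm_coe_mul_apply_le`). [cite: BorelJacquet1979, §1.2] [cite: Kudla1994, §2] -/
theorem norm_cornerLoc_mul_apply_le (u : UnitaryGroup.localPi L (IsCMField.complexConj L) (n₂ + n₂) (hermD L eB dB hdB dW hdW) v)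
    (x : UnitaryGroup.localPi L (IsCMField.complexConj L) (n + n) (hermD L eV dV hdV dW hdW) v) (w : UnitaryGroup.PlacesOver L v) {Ru Rx : ℝ} (hRx : 0 ≤ Rx)
    (hu : ∀ a b, ‖(((u : UnitaryGroup.LocalGLPi L (n₂ + n₂) v) w : GL (Fin (n₂ + n₂)) (w.1.adicCompletion L)) : Matrix (Fin (n₂ + n₂)) (Fin (n₂ + n₂)) (w.1.adicCompletion L)) a b‖ ≤ Ru)
    (hx : ∀ a b, ‖(((x : UnitaryGroup.LocalGLPi L (n + n) v) w : GL (Fin (n + n)) (w.1.adicCompletion L)) : Matrix (Fin (n + n)) (Fin (n + n)) (w.1.adicCompletion L)) a b‖ ≤ Rx)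
    (a b : Fin (n + n)) :
    ‖((((UnitaryGroup.evalPlace (Fp L) L (IsCMField.complexConj L) (n + n) (hermD L eV dV hdV dW hdW) v (UnitaryGroup.finPart (Fp L) L (IsCMField.complexConj L) (n + n) (hermD L eV dV hdV dW hdW)
        (blkD L eV eA eB dA hdA dB hdB dV hdV hVA hVB dW hdW (1, locToAdelic L eB dB hdB dW hdW v u))) * x : UnitaryGroup.localPi L (IsCMField.complexConj L) (n + n) (hermD L eV dV hdV dW hdW) v) :
        UnitaryGroup.LocalGLPi L (n + n) v) w : GL (Fin (n + n)) (w.1.adicCompletion L)) : Matrix (Fin (n + n)) (Fin (n + n)) (w.1.adicCompletion L)) a b‖ ≤ max 1 Ru * Rx :=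
  haveI : Algebra.IsQuadraticExtension (Fp L) L := IsCMField.isQuadraticExtension L
  norm_coe_mul_apply_le (Fp L) L (IsCMField.complexConj L) v n _ _ w (zero_le_one.trans (le_max_left _ _)) hRx (norm_cornerLoc_apply_le L eV eA eB dA hdA dB hdB dV hdV hVA hVB dW hdW v u w hu) hx a b

/-- **at the translate's component `x = g_v`**: the entries of `(B_v(u)·g_v)_w` have norm `≤ max(1, R_u)·H_w(g)` (★ `norm_apply_evalPlace_le_localHeight`). [cite: BorelJacquet1979, §1.2, §4.1] -/
theorem norm_cornerLoc_mul_evalPlace_apply_le [NeZero (n + n)] (u : UnitaryGroup.localPi L (IsCMField.complexConj L) (n₂ + n₂) (hermD L eB dB hdB dW hdW) v) (g : HA L eV dV hdV dW hdW)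
    (w : UnitaryGroup.PlacesOver L v) {Ru : ℝ}
    (hu : ∀ a b, ‖(((u : UnitaryGroup.LocalGLPi L (n₂ + n₂) v) w : GL (Fin (n₂ + n₂)) (w.1.adicCompletion L)) : Matrix (Fin (n₂ + n₂)) (Fin (n₂ + n₂)) (w.1.adicCompletion L)) a b‖ ≤ Ru)
    (a b : Fin (n + n)) :
    ‖((((UnitaryGroup.evalPlace (Fp L) L (IsCMField.complexConj L) (n + n) (hermD L eV dV hdV dW hdW) v (UnitaryGroup.finPart (Fp L) L (IsCMField.complexConj L) (n + n) (hermD L eV dV hdV dW hdW)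
        (blkD L eV eA eB dA hdA dB hdB dV hdV hVA hVB dW hdW (1, locToAdelic L eB dB hdB dW hdW v u))) *
        UnitaryGroup.evalPlace (Fp L) L (IsCMField.complexConj L) (n + n) (hermD L eV dV hdV dW hdW) v (UnitaryGroup.finPart (Fp L) L (IsCMField.complexConj L) (n + n) (hermD L eV dV hdV dW hdW) g) :
        UnitaryGroup.localPi L (IsCMField.complexConj L) (n + n) (hermD L eV dV hdV dW hdW) v) :
        UnitaryGroup.LocalGLPi L (n + n) v) w : GL (Fin (n + n)) (w.1.adicCompletion L)) : Matrix (Fin (n + n)) (Fin (n + n)) (w.1.adicCompletion L)) a b‖ ≤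
      max 1 Ru * (GLn.localHeight (n + n) L w.1 (g : GL (Fin (n + n)) (AdeleRing (𝓞 L) L)) : ℝ) :=
  norm_cornerLoc_mul_apply_le L eV eA eB dA hdA dB hdB dV hdV hVA hVB dW hdW v u _ w NNReal.zero_le_coe hu (norm_apply_evalPlace_le_localHeight L eV dV hdV dW hdW g w) a b

end Corner

/-! ## §2 The unramified section `Λ_{s,v}` has entry-size constant `1` at every place -/

section Lambda

variable {N M n : ℕ} (e : Fin N × Fin M ≃ Fin n)
  (dV : Fin N → L) (hdV : ∀ i, IsCMField.complexConj L (dV i) = dV i)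
  (dW : Fin M → L) (hdW : ∀ i, IsCMField.complexConj L (dW i) = dW i)
  (v : HeightOneSpectrum (𝓞 (Fp L)))

/-- **THE ENTRY-SIZE LETTER OF `Λ_{s,v}`, EVERY PLACE, CONSTANT `1`.**  For `χ` unitary above `v` and unramified above `v`, `0 ≤ re s + n∕2`, and `g ∈ H(L⁺_v)` whose
`w`-components have entries of norm `≤ R_w` (`1 ≤ R_w`): `‖Λ_{s,v}(g)‖ ≤ (∏_{w∣v} R_w^n)^{re s + n∕2}`.  Either `g ∉ P_Δ(L⁺_v)·K_{H,v}` and `Λ_{s,v}(g) = 0`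
(★ `lambdaLoc_eq_zero`), or `g = p·κ` with `p ∈ P_Δ`, `κ ∈ K_{H,v}`: then `Λ_{s,v}` is a Siegel section (★ `lambdaLoc_mem_localDegPS`), `Λ_{s,v}(κ) = 1` (★ `lambdaLoc_of_mem_localInt`),
`κ⁻¹ ∈ K_{H,v}` has entries of norm `≤ 1` (★ `norm_apply_le_one_of_mem_localInt`), and the ENGINE ★ `norm_section_le_of_decomp` gives the bound.
[cite: Li1992, §3] [cite: KudlaRallis1994, §2] [cite: HarrisKudlaSweet1996, §1 (1.15)] [cite: Casselman1980, §3] [cite: BorelJacquet1979, §1.2] -/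
theorem norm_lambdaLoc_le_of_entries {χ : HeckeCharacter L}
    (hχu : ∀ (w : UnitaryGroup.PlacesOver L v) (u : (w.1.adicCompletion L)ˣ), ‖((χ.localComponent w.1 u : ℂˣ) : ℂ)‖ = 1)
    (hχv : ∀ w : UnitaryGroup.PlacesOver L v, χ.IsUnramifiedAt w.1) {s : ℂ} (hs : 0 ≤ s.re + (n : ℝ) / 2)
    (g : UnitaryGroup.localPi L (IsCMField.complexConj L) (n + n) (hermD L e dV hdV dW hdW) v) {R : UnitaryGroup.PlacesOver L v → ℝ} (hR1 : ∀ w, 1 ≤ R w)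
    (hg : ∀ (w : UnitaryGroup.PlacesOver L v) (a b : Fin (n + n)),
      ‖(((g : UnitaryGroup.LocalGLPi L (n + n) v) w : GL (Fin (n + n)) (w.1.adicCompletion L)) : Matrix (Fin (n + n)) (Fin (n + n)) (w.1.adicCompletion L)) a b‖ ≤ R w) :
    ‖LambdaLoc L e dV hdV dW hdW v χ s g‖ ≤ (∏ w : UnitaryGroup.PlacesOver L v, R w ^ n) ^ (s.re + (n : ℝ) / 2) := by
  haveI : Algebra.IsQuadraticExtension (Fp L) L := IsCMField.isQuadraticExtension L
  have hR0 : ∀ w, 0 ≤ R w := fun w => zero_le_one.trans (hR1 w)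
  by_cases hdec : ∃ pk, IsSiegelIntDecomp L e dV hdV dW hdW v g pk
  · obtain ⟨⟨p, κ⟩, hp, hκ, hpk⟩ := hdec
    dsimp only at hp hκ hpk
    have hΦ := (lambdaLoc_mem_localDegPS L e dV hdV dW hdW v χ s hχv).1
    have hp' := (mem_siegelDeltaLoc_iff_local L e dV hdV dW hdW v p).1 hp
    have hΦk : ‖LambdaLoc L e dV hdV dW hdW v χ s κ‖ ≤ 1 := by
      rw [lambdaLoc_of_mem_localInt L e dV hdV dW hdW v χ s hχv hκ, norm_one]
    have hkR : ∀ (w : UnitaryGroup.PlacesOver L v) (a b : Fin (n + n)),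
        ‖((((κ⁻¹ : UnitaryGroup.localPi L (IsCMField.complexConj L) (n + n) (hermD L e dV hdV dW hdW) v) : UnitaryGroup.LocalGLPi L (n + n) v) w : GL (Fin (n + n)) (w.1.adicCompletion L)) :
          Matrix (Fin (n + n)) (Fin (n + n)) (w.1.adicCompletion L)) a b‖ ≤ (1 : ℝ) :=
      fun w a b => norm_apply_le_one_of_mem_localInt L e dV hdV dW hdW v (inv_mem hκ) w a b
    have h := norm_section_le_of_decomp (Fp L) L (IsCMField.complexConj L) (complexConj_imagUnit L) (imagUnit_ne_zero L) (imagUnit_mul_self L) v n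
      (hermD_eq_map_gramD L e dV hdV dW hdW) (gramR_isSymm L e dV hdV dW hdW) hχu hs hΦ hp' hpk hΦk hR0 (fun _ => zero_le_one) (fun w => by rw [mul_one]; exact hR1 w) hg hkR
    simpa only [mul_one, one_mul] using h
  · rw [lambdaLoc_eq_zero L e dV hdV dW hdW v χ s hdec, norm_zero]
    exact Real.rpow_nonneg (Finset.prod_nonneg fun w _ => pow_nonneg (hR0 w) _) _

end Lambda

/-! ## §3 The value letters of the translate, from an entry-size letter -/

section Value

variable {N₁ N₂ M n n₁ n₂ : ℕ} (eV : Fin (N₁ + N₂) × Fin M ≃ Fin n) (eA : Fin N₁ × Fin M ≃ Fin n₁) (eB : Fin N₂ × Fin M ≃ Fin n₂)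
  (dA : Fin N₁ → L) (hdA : ∀ i, IsCMField.complexConj L (dA i) = dA i)
  (dB : Fin N₂ → L) (hdB : ∀ i, IsCMField.complexConj L (dB i) = dB i)
  (dV : Fin (N₁ + N₂) → L) (hdV : ∀ i, IsCMField.complexConj L (dV i) = dV i)
  (hVA : ∀ i, dV (Fin.castAdd N₂ i) = dA i) (hVB : ∀ j, dV (Fin.natAdd N₁ j) = dB j)
  (dW : Fin M → L) (hdW : ∀ i, IsCMField.complexConj L (dW i) = dW i)
  (v : HeightOneSpectrum (𝓞 (Fp L)))

/-- **VALUE LETTER FROM AN ENTRY-SIZE LETTER.**  If `‖Φ g′‖ ≤ B_Φ·(∏_w R_w^n)^{e_Φ}` whenever the entries of `g′_w` have norm `≤ R_w` (`R_w ≥ 1`), then at the translated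
corner argument: `‖Φ(B_v(u)·x)‖ ≤ B_Φ·(∏_w (max(1,R_u)·R_{x,w})^n)^{e_Φ}` (§1). [cite: Kudla1994, §2–§3] [cite: BorelJacquet1979, §1.2] [cite: Shimura1997, §18.4 Prop. 18.14] -/
theorem norm_apply_cornerLoc_mul_le {Φ : UnitaryGroup.localPi L (IsCMField.complexConj L) (n + n) (hermD L eV dV hdV dW hdW) v → ℂ} {BΦ eΦ : ℝ}
    (hΦR : ∀ (g' : UnitaryGroup.localPi L (IsCMField.complexConj L) (n + n) (hermD L eV dV hdV dW hdW) v) (R : UnitaryGroup.PlacesOver L v → ℝ), (∀ w, 1 ≤ R w) →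
      (∀ (w : UnitaryGroup.PlacesOver L v) (a b : Fin (n + n)),
        ‖(((g' : UnitaryGroup.LocalGLPi L (n + n) v) w : GL (Fin (n + n)) (w.1.adicCompletion L)) : Matrix (Fin (n + n)) (Fin (n + n)) (w.1.adicCompletion L)) a b‖ ≤ R w) →
      ‖Φ g'‖ ≤ BΦ * (∏ w : UnitaryGroup.PlacesOver L v, R w ^ n) ^ eΦ)
    (u : UnitaryGroup.localPi L (IsCMField.complexConj L) (n₂ + n₂) (hermD L eB dB hdB dW hdW) v) {Ru : ℝ}
    (hu : ∀ (w : UnitaryGroup.PlacesOver L v) (a b : Fin (n₂ + n₂)),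
      ‖(((u : UnitaryGroup.LocalGLPi L (n₂ + n₂) v) w : GL (Fin (n₂ + n₂)) (w.1.adicCompletion L)) : Matrix (Fin (n₂ + n₂)) (Fin (n₂ + n₂)) (w.1.adicCompletion L)) a b‖ ≤ Ru)
    (x : UnitaryGroup.localPi L (IsCMField.complexConj L) (n + n) (hermD L eV dV hdV dW hdW) v) {Rx : UnitaryGroup.PlacesOver L v → ℝ} (hRx1 : ∀ w, 1 ≤ Rx w)
    (hx : ∀ (w : UnitaryGroup.PlacesOver L v) (a b : Fin (n + n)),
      ‖(((x : UnitaryGroup.LocalGLPi L (n + n) v) w : GL (Fin (n + n)) (w.1.adicCompletion L)) : Matrix (Fin (n + n)) (Fin (n + n)) (w.1.adicCompletion L)) a b‖ ≤ Rx w) :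
    ‖Φ (UnitaryGroup.evalPlace (Fp L) L (IsCMField.complexConj L) (n + n) (hermD L eV dV hdV dW hdW) v (UnitaryGroup.finPart (Fp L) L (IsCMField.complexConj L) (n + n) (hermD L eV dV hdV dW hdW)
        (blkD L eV eA eB dA hdA dB hdB dV hdV hVA hVB dW hdW (1, locToAdelic L eB dB hdB dW hdW v u))) * x)‖ ≤
      BΦ * (∏ w : UnitaryGroup.PlacesOver L v, (max 1 Ru * Rx w) ^ n) ^ eΦ :=
  hΦR _ (fun w => max 1 Ru * Rx w) (fun w => one_le_mul_of_one_le_of_one_le (le_max_left _ _) (hRx1 w))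
    fun w a b => norm_cornerLoc_mul_apply_le L eV eA eB dA hdA dB hdB dV hdV hVA hVB dW hdW v u x w (zero_le_one.trans (hRx1 w)) (hu w) (hx w) a b

/-- **VALUE LETTER AT THE TRANSLATE `x = g_v`, IN THE CURRENCY `H_w(g)` OF ★ `hFfin_of_placeBounds`**: `‖Φ(B_v(u)·g_v)‖ ≤ B_Φ·(∏_w (max(1,R_u)·H_w(g))^n)^{e_Φ}`
(§1, ★ `GLn.one_le_localHeight`). [cite: Kudla1994, §2–§3] [cite: BorelJacquet1979, §1.2, §4.1] [cite: Shimura1997, §18.4 Prop. 18.14] -/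
theorem norm_apply_cornerLoc_mul_evalPlace_le [NeZero (n + n)] {Φ : UnitaryGroup.localPi L (IsCMField.complexConj L) (n + n) (hermD L eV dV hdV dW hdW) v → ℂ} {BΦ eΦ : ℝ}
    (hΦR : ∀ (g' : UnitaryGroup.localPi L (IsCMField.complexConj L) (n + n) (hermD L eV dV hdV dW hdW) v) (R : UnitaryGroup.PlacesOver L v → ℝ), (∀ w, 1 ≤ R w) →
      (∀ (w : UnitaryGroup.PlacesOver L v) (a b : Fin (n + n)),
        ‖(((g' : UnitaryGroup.LocalGLPi L (n + n) v) w : GL (Fin (n + n)) (w.1.adicCompletion L)) : Matrix (Fin (n + n)) (Fin (n + n)) (w.1.adicCompletion L)) a b‖ ≤ R w) →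
      ‖Φ g'‖ ≤ BΦ * (∏ w : UnitaryGroup.PlacesOver L v, R w ^ n) ^ eΦ)
    (u : UnitaryGroup.localPi L (IsCMField.complexConj L) (n₂ + n₂) (hermD L eB dB hdB dW hdW) v) {Ru : ℝ}
    (hu : ∀ (w : UnitaryGroup.PlacesOver L v) (a b : Fin (n₂ + n₂)),
      ‖(((u : UnitaryGroup.LocalGLPi L (n₂ + n₂) v) w : GL (Fin (n₂ + n₂)) (w.1.adicCompletion L)) : Matrix (Fin (n₂ + n₂)) (Fin (n₂ + n₂)) (w.1.adicCompletion L)) a b‖ ≤ Ru)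
    (g : HA L eV dV hdV dW hdW) :
    ‖Φ (UnitaryGroup.evalPlace (Fp L) L (IsCMField.complexConj L) (n + n) (hermD L eV dV hdV dW hdW) v (UnitaryGroup.finPart (Fp L) L (IsCMField.complexConj L) (n + n) (hermD L eV dV hdV dW hdW)
        (blkD L eV eA eB dA hdA dB hdB dV hdV hVA hVB dW hdW (1, locToAdelic L eB dB hdB dW hdW v u))) *
        UnitaryGroup.evalPlace (Fp L) L (IsCMField.complexConj L) (n + n) (hermD L eV dV hdV dW hdW) v (UnitaryGroup.finPart (Fp L) L (IsCMField.complexConj L) (n + n) (hermD L eV dV hdV dW hdW) g))‖ ≤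
      BΦ * (∏ w : UnitaryGroup.PlacesOver L v, (max 1 Ru * (GLn.localHeight (n + n) L w.1 (g : GL (Fin (n + n)) (AdeleRing (𝓞 L) L)) : ℝ)) ^ n) ^ eΦ :=
  norm_apply_cornerLoc_mul_le L eV eA eB dA hdA dB hdB dV hdV hVA hVB dW hdW v hΦR u hu _ (fun w => NNReal.one_le_coe.2 (GLn.one_le_localHeight w.1 _))
    fun w => norm_apply_evalPlace_le_localHeight L eV dV hdV dW hdW g w

/-- **THE VALUE LETTER OF `Λ_{s,v}` AT THE TRANSLATED CORNER ARGUMENT, EVERY PLACE**: for `χ` unitary and unramified above `v`, `0 ≤ re s + n∕2`, `u ∈ H^{(B)}(L⁺_v)` with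
entries of norm `≤ R_u` above `v`, and any `g ∈ H(𝔸)`: `‖Λ_{s,v}(B_v(u)·g_v)‖ ≤ (∏_{w∣v} (max(1,R_u)·H_w(g))^n)^{re s + n∕2}` (§2 is the entry-size letter with constant `1`).
[cite: Li1992, §3] [cite: KudlaRallis1994, §2] [cite: Kudla1994, §2–§3] [cite: BorelJacquet1979, §1.2, §4.1] -/
theorem norm_lambdaLoc_cornerLoc_mul_evalPlace_le [NeZero (n + n)] {χ : HeckeCharacter L}
    (hχu : ∀ (w : UnitaryGroup.PlacesOver L v) (u : (w.1.adicCompletion L)ˣ), ‖((χ.localComponent w.1 u : ℂˣ) : ℂ)‖ = 1)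
    (hχv : ∀ w : UnitaryGroup.PlacesOver L v, χ.IsUnramifiedAt w.1) {s : ℂ} (hs : 0 ≤ s.re + (n : ℝ) / 2)
    (u : UnitaryGroup.localPi L (IsCMField.complexConj L) (n₂ + n₂) (hermD L eB dB hdB dW hdW) v) {Ru : ℝ}
    (hu : ∀ (w : UnitaryGroup.PlacesOver L v) (a b : Fin (n₂ + n₂)),
      ‖(((u : UnitaryGroup.LocalGLPi L (n₂ + n₂) v) w : GL (Fin (n₂ + n₂)) (w.1.adicCompletion L)) : Matrix (Fin (n₂ + n₂)) (Fin (n₂ + n₂)) (w.1.adicCompletion L)) a b‖ ≤ Ru)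
    (g : HA L eV dV hdV dW hdW) :
    ‖LambdaLoc L eV dV hdV dW hdW v χ s (UnitaryGroup.evalPlace (Fp L) L (IsCMField.complexConj L) (n + n) (hermD L eV dV hdV dW hdW) v (UnitaryGroup.finPart (Fp L) L (IsCMField.complexConj L) (n + n) (hermD L eV dV hdV dW hdW)
        (blkD L eV eA eB dA hdA dB hdB dV hdV hVA hVB dW hdW (1, locToAdelic L eB dB hdB dW hdW v u))) *
        UnitaryGroup.evalPlace (Fp L) L (IsCMField.complexConj L) (n + n) (hermD L eV dV hdV dW hdW) v (UnitaryGroup.finPart (Fp L) L (IsCMField.complexConj L) (n + n) (hermD L eV dV hdV dW hdW) g))‖ ≤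
      (∏ w : UnitaryGroup.PlacesOver L v, (max 1 Ru * (GLn.localHeight (n + n) L w.1 (g : GL (Fin (n + n)) (AdeleRing (𝓞 L) L)) : ℝ)) ^ n) ^ (s.re + (n : ℝ) / 2) := by
  have h := norm_apply_cornerLoc_mul_evalPlace_le L eV eA eB dA hdA dB hdB dV hdV hVA hVB dW hdW v (Φ := LambdaLoc L eV dV hdV dW hdW v χ s) (BΦ := 1) (eΦ := s.re + (n : ℝ) / 2)
    (fun g' R hR1 hg' => by rw [one_mul]; exact norm_lambdaLoc_le_of_entries L eV dV hdV dW hdW v hχu hχv hs g' hR1 hg') u hu g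
  rwa [one_mul] at h

end Value

end Summit.HodgeConjecture.HodgeConjecture.Cruxes.HLiu418.K2LiuKindOneLineLocalTranslateSize

end
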